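import Summits.Ventures.PercRepro.S1CoreCapSpecSpreadFour

/-!
# PercRepro — THE INSTANCE `ν = 4` OF THE SPREAD SPEC, THIRD LEG, PART 1: THE E-LINES (p1, gen 31)

`proofs/P1-S2-CORANK6.md` §4d–§4e. Configurations of simple 3-point lines (weights `1`) of cost `≤ 4` with the spread clause
`h7 : lineRank l ≤ 4 → #(unionL l) ≤ lineRank l + 3`. Five pairwise disjoint lines cost `5` (`not_five_disjoint`), so two lines meet, say
`A ∩ B = {v}`. The **E-lines** — the lines with two points on `A ∪ B` (`{a, b, t}`, `a ∈ A ∖ v`, `b ∈ B ∖ v`, `t` off `A ∪ B`) — all share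
their third point `t` (`E_common_third`: the list `[E', E, B, A]` has `lineRank 3`, so its union has `≤ 6` points) and have distinct `A`-points
(`E_points_ne`), so there are at most two of them (`E_card_le_two`). Part 2 (S1CoreCapSpecSpreadFourLinesF) bounds the F-lines, the main file
(S1CoreCapSpecSpreadFourMain) assembles `fourCapSpecSpread_four : FourCapSpecSpread capPaper 4 6`. Axioms: standard.
-/


namespace PercRepro

namespace S1

namespace FourCap

variable {β : Type} [DecidableEq β]

section Lines

variable {w : β → ℕ} {ls : Finset (Finset β)}
  (hw1 : ∀ L ∈ ls, ∀ v ∈ L, w v = 1)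
  (hcard : ∀ L ∈ ls, L.card = 3)
  (h3 : ∀ L ∈ ls, ∀ L' ∈ ls, L ≠ L' → (L ∩ L').card ≤ 1)
  (h4 : ∀ l : List (Finset β), l.Nodup → (∀ L ∈ l, L ∈ ls) → wsum w (unionL l) ≤ 4 + lineRank l)
  (h7 : ∀ l : List (Finset β), l.Nodup → (∀ L ∈ l, L ∈ ls) → lineRank l ≤ 4 → wsum w (unionL l) ≤ lineRank l + 3)

include hw1 in
/-- With all weights `1`, the weight of a union of lines of the configuration is its number of points. -/
theorem wsum_unionL_eq_card (l : List (Finset β)) (hl : ∀ L ∈ l, L ∈ ls) :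
    wsum w (unionL l) = (unionL l).card := by
  unfold wsum
  rw [Finset.card_eq_sum_ones]
  refine Finset.sum_congr rfl (fun v hv => ?_)
  obtain ⟨L, hL, hvL⟩ := mem_unionL_iff.1 hv
  exact hw1 L (hl L hL) v hvL

include hw1 hcard h4 in
/-- **Five pairwise disjoint lines are too expensive** (cost `5`). -/
theorem not_five_disjoint {A B C D E : Finset β} (hA : A ∈ ls) (hB : B ∈ ls) (hC : C ∈ ls) (hD : D ∈ ls) (hE : E ∈ ls)
    (hBA : Disjoint B A) (hCA : Disjoint C A) (hCB : Disjoint C B) (hDA : Disjoint D A) (hDB : Disjoint D B)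
    (hDC : Disjoint D C) (hEA : Disjoint E A) (hEB : Disjoint E B) (hEC : Disjoint E C) (hED : Disjoint E D) : False := by
  have hne : ∀ {X Y : Finset β}, X ∈ ls → Disjoint X Y → X ≠ Y := by
    intro X Y hX hXY hXY'
    subst hXY'
    have := hcard X hX
    rw [Finset.disjoint_self_iff_empty] at hXY
    rw [hXY] at this
    simp at this
  have hc := h4 [E, D, C, B, A]
    (by simp [hne hB hBA, hne hC hCA, hne hC hCB, hne hD hDA, hne hD hDB, hne hD hDC, hne hE hEA, hne hE hEB,
      hne hE hEC, hne hE hED])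
    (by simp [hA, hB, hC, hD, hE])
  rw [wsum_unionL_eq_card hw1 _ (by simp [hA, hB, hC, hD, hE])] at hc
  simp only [unionL, lineRank, Finset.union_empty, Finset.sdiff_empty, Finset.inter_empty, Finset.card_empty,
    Nat.zero_add] at hc
  have hU1 : (A).card = 3 := hcard A hA
  have e1 : (B ∪ A).card = 6 := by
    rw [Finset.card_union_of_disjoint hBA, hcard A hA, hcard B hB]
  have e2 : (C ∪ (B ∪ A)).card = 9 := by
    rw [Finset.card_union_of_disjoint (Finset.disjoint_union_right.2 ⟨hCB, hCA⟩), hcard C hC, e1]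
  have e3 : (D ∪ (C ∪ (B ∪ A))).card = 12 := by
    rw [Finset.card_union_of_disjoint (Finset.disjoint_union_right.2 ⟨hDC, Finset.disjoint_union_right.2 ⟨hDB, hDA⟩⟩),
      hcard D hD, e2]
  have e4 : (E ∪ (D ∪ (C ∪ (B ∪ A)))).card = 15 := by
    rw [Finset.card_union_of_disjoint (Finset.disjoint_union_right.2 ⟨hED, Finset.disjoint_union_right.2 ⟨hEC,
      Finset.disjoint_union_right.2 ⟨hEB, hEA⟩⟩⟩), hcard E hE, e3]
  -- the sdiffs are the lines themselves, the intersections empty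
  have s1 : (B \ A) = B := Finset.sdiff_eq_self_of_disjoint hBA
  have s2 : (C \ (B ∪ A)) = C := Finset.sdiff_eq_self_of_disjoint (Finset.disjoint_union_right.2 ⟨hCB, hCA⟩)
  have s3 : (D \ (C ∪ (B ∪ A))) = D :=
    Finset.sdiff_eq_self_of_disjoint (Finset.disjoint_union_right.2 ⟨hDC, Finset.disjoint_union_right.2 ⟨hDB, hDA⟩⟩)
  have s4 : (E \ (D ∪ (C ∪ (B ∪ A)))) = E :=
    Finset.sdiff_eq_self_of_disjoint (Finset.disjoint_union_right.2 ⟨hED, Finset.disjoint_union_right.2 ⟨hEC,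
      Finset.disjoint_union_right.2 ⟨hEB, hEA⟩⟩⟩)
  have i1 : (B ∩ A) = ∅ := Finset.disjoint_iff_inter_eq_empty.1 hBA
  have i2 : (C ∩ (B ∪ A)) = ∅ := Finset.disjoint_iff_inter_eq_empty.1 (Finset.disjoint_union_right.2 ⟨hCB, hCA⟩)
  have i3 : (D ∩ (C ∪ (B ∪ A))) = ∅ :=
    Finset.disjoint_iff_inter_eq_empty.1 (Finset.disjoint_union_right.2 ⟨hDC, Finset.disjoint_union_right.2 ⟨hDB, hDA⟩⟩)
  have i4 : (E ∩ (D ∪ (C ∪ (B ∪ A)))) = ∅ :=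
    Finset.disjoint_iff_inter_eq_empty.1 (Finset.disjoint_union_right.2 ⟨hED, Finset.disjoint_union_right.2 ⟨hEC,
      Finset.disjoint_union_right.2 ⟨hEB, hEA⟩⟩⟩)
  rw [s1, s2, s3, s4, i1, i2, i3, i4, e4, hcard A hA, hcard B hB, hcard C hC, hcard D hD, hcard E hE] at hc
  simp at hc

include hw1 in
/-- With all weights `1`, the weight of the part of a line off a set is its number of points. -/
theorem wsum_sdiff_eq_card {L : Finset β} (hL : L ∈ ls) (U : Finset β) : wsum w (L \ U) = (L \ U).card := by
  unfold wsum
  rw [Finset.card_eq_sum_ones]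
  exact Finset.sum_congr rfl (fun v hv => hw1 L hL v (Finset.mem_sdiff.1 hv).1)

include hw1 hcard h7 in
/-- **Two lines with two points each on `A ∪ B` share their third point** (`A ∩ B = {v}`): the list `[E', E, B, A]` has
`lineRank 3`, so its union has `≤ 6` points, while `E ∪ B ∪ A` already has `6`. -/
theorem E_common_third {A B E E' : Finset β} (hA : A ∈ ls) (hB : B ∈ ls) (hE : E ∈ ls) (hE' : E' ∈ ls)
    (hAB : (B ∩ A).card = 1) (hEA : E ≠ A) (hEB : E ≠ B) (hE'A : E' ≠ A) (hE'B : E' ≠ B) (hEE' : E' ≠ E)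
    (hk : (E ∩ (B ∪ A)).card = 2) (hk' : (E' ∩ (B ∪ A)).card = 2) : E' \ (B ∪ A) = E \ (B ∪ A) := by
  have hBA : B ≠ A := by
    rintro rfl
    rw [Finset.inter_self, hcard B hB] at hAB
    omega
  have hsp := h7 [E', E, B, A] (by simp [hBA, hEA, hEB, hE'A, hE'B, hEE']) (by simp [hA, hB, hE, hE'])
  rw [wsum_unionL_eq_card hw1 _ (by simp [hA, hB, hE, hE'])] at hsp
  simp only [unionL, lineRank, Finset.union_empty, Finset.sdiff_empty, Finset.inter_empty, Finset.card_empty,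
    Nat.zero_add] at hsp
  have kA := hcard A hA
  have kB := hcard B hB
  have kE := hcard E hE
  have kE' := hcard E' hE'
  have sB : (B \ A).card + (B ∩ A).card = B.card := Finset.card_sdiff_add_card_inter B A
  have sE : (E \ (B ∪ A)).card + (E ∩ (B ∪ A)).card = E.card := Finset.card_sdiff_add_card_inter E (B ∪ A)
  have sE' : (E' \ (E ∪ (B ∪ A))).card + (E' ∩ (E ∪ (B ∪ A))).card = E'.card :=
    Finset.card_sdiff_add_card_inter E' (E ∪ (B ∪ A))
  have iE' : (E' ∩ (B ∪ A)).card ≤ (E' ∩ (E ∪ (B ∪ A))).card :=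
    Finset.card_le_card (Finset.inter_subset_inter_left Finset.subset_union_right)
  have uBA : (B ∪ A).card = 5 := by
    have := Finset.card_union_add_card_inter B A
    omega
  have uE : (E ∪ (B ∪ A)).card = 6 := by
    have := Finset.card_union_add_card_inter E (B ∪ A)
    omega
  have uE' := Finset.card_sdiff_add_card E' (E ∪ (B ∪ A))
  have hzero : (E' \ (E ∪ (B ∪ A))).card = 0 := by omega
  have hsub : E' ⊆ E ∪ (B ∪ A) := Finset.sdiff_eq_empty_iff_subset.1 (Finset.card_eq_zero.1 hzero)
  -- `E' ∖ (B ∪ A) ⊆ E ∖ (B ∪ A)`, both of one point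
  have hsub' : E' \ (B ∪ A) ⊆ E \ (B ∪ A) := by
    intro x hx
    rw [Finset.mem_sdiff] at hx ⊢
    have := hsub hx.1
    rw [Finset.mem_union] at this
    exact ⟨this.resolve_right hx.2, hx.2⟩
  have c1 : (E \ (B ∪ A)).card = 1 := by omega
  have c1' : (E' \ (B ∪ A)).card = 1 := by
    have := Finset.card_sdiff_add_card_inter E' (B ∪ A)
    omega
  exact Finset.eq_of_subset_of_card_le hsub' (by omega)

include h3 in
/-- An E-line (two points on `A ∪ B`, `A ∩ B = {v}`) meets `A` in exactly one point, which is not on `B`. -/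
theorem E_point_on_A {A B E : Finset β} (hA : A ∈ ls) (hB : B ∈ ls) (hE : E ∈ ls) (hEA : E ≠ A) (hEB : E ≠ B)
    (hk : (E ∩ (B ∪ A)).card = 2) : ∃ a, E ∩ A = {a} ∧ a ∉ B := by
  have h1 : (E ∩ A).card ≤ 1 := h3 E hE A hA hEA
  have h2 : (E ∩ B).card ≤ 1 := h3 E hE B hB hEB
  have hsplit : E ∩ (B ∪ A) = (E ∩ B) ∪ (E ∩ A) := Finset.inter_union_distrib_left E B A
  have hle : (E ∩ (B ∪ A)).card ≤ (E ∩ B).card + (E ∩ A).card := by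
    rw [hsplit]; exact Finset.card_union_le _ _
  have hEA1 : (E ∩ A).card = 1 := by omega
  obtain ⟨a, ha⟩ := Finset.card_eq_one.1 hEA1
  refine ⟨a, ha, fun haB => ?_⟩
  have haE : a ∈ E := (Finset.mem_inter.1 (ha ▸ Finset.mem_singleton_self a)).1
  have hEB1 : E ∩ B = {a} := by
    apply Finset.eq_singleton_iff_unique_mem.2
    refine ⟨Finset.mem_inter.2 ⟨haE, haB⟩, fun x hx => ?_⟩
    exact Finset.card_le_one.1 h2 x hx a (Finset.mem_inter.2 ⟨haE, haB⟩)
  rw [hsplit, hEB1, ha, Finset.union_self, Finset.card_singleton] at hk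
  omega

include hw1 hcard h3 h7 in
/-- Two distinct E-lines have distinct `A`-points (they already share their third point). -/
theorem E_points_ne {A B E E' : Finset β} (hA : A ∈ ls) (hB : B ∈ ls) (hE : E ∈ ls) (hE' : E' ∈ ls)
    (hAB : (B ∩ A).card = 1) (hEA : E ≠ A) (hEB : E ≠ B) (hE'A : E' ≠ A) (hE'B : E' ≠ B) (hEE' : E' ≠ E)
    (hk : (E ∩ (B ∪ A)).card = 2) (hk' : (E' ∩ (B ∪ A)).card = 2) {a : β} (ha : E ∩ A = {a}) (ha' : E' ∩ A = {a}) :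
    False := by
  have hcommon := E_common_third hw1 hcard h7 hA hB hE hE' hAB hEA hEB hE'A hE'B hEE' hk hk'
  have kE := hcard E hE
  have c1 : (E \ (B ∪ A)).card = 1 := by
    have := Finset.card_sdiff_add_card_inter E (B ∪ A)
    omega
  obtain ⟨t, ht⟩ := Finset.card_eq_one.1 c1
  have htE : t ∈ E ∧ t ∉ B ∪ A := Finset.mem_sdiff.1 (ht ▸ Finset.mem_singleton_self t)
  have htE' : t ∈ E' := (Finset.mem_sdiff.1 (hcommon ▸ ht ▸ Finset.mem_singleton_self t)).1
  have haE : a ∈ E := (Finset.mem_inter.1 (ha ▸ Finset.mem_singleton_self a)).1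
  have haA : a ∈ A := (Finset.mem_inter.1 (ha ▸ Finset.mem_singleton_self a)).2
  have haE' : a ∈ E' := (Finset.mem_inter.1 (ha' ▸ Finset.mem_singleton_self a)).1
  have hat : a ≠ t := fun h => htE.2 (h ▸ Finset.mem_union_right _ haA)
  have hsub : ({a, t} : Finset β) ⊆ E' ∩ E := by
    intro x hx
    simp only [Finset.mem_insert, Finset.mem_singleton] at hx
    rcases hx with rfl | rfl
    · exact Finset.mem_inter.2 ⟨haE', haE⟩
    · exact Finset.mem_inter.2 ⟨htE', htE.1⟩
  have := Finset.card_le_card hsub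
  rw [Finset.card_pair hat] at this
  have := h3 E' hE' E hE hEE'
  omega

include hw1 hcard h3 h7 in
/-- **At most two E-lines**: their `A`-points are distinct points of `A ∖ B` (two points). -/
theorem E_card_le_two {A B : Finset β} (hA : A ∈ ls) (hB : B ∈ ls) (hAB : (B ∩ A).card = 1) :
    (ls.filter (fun L => L ≠ A ∧ L ≠ B ∧ (L ∩ (B ∪ A)).card = 2)).card ≤ 2 := by
  by_contra hlt
  push Not at hlt
  obtain ⟨E₁, E₂, E₃, h1, h2, h3', h12, h13, h23⟩ := Finset.two_lt_card_iff.1 hlt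
  simp only [Finset.mem_filter] at h1 h2 h3'
  obtain ⟨a₁, ha₁, ha₁B⟩ := E_point_on_A h3 hA hB h1.1 h1.2.1 h1.2.2.1 h1.2.2.2
  obtain ⟨a₂, ha₂, ha₂B⟩ := E_point_on_A h3 hA hB h2.1 h2.2.1 h2.2.2.1 h2.2.2.2
  obtain ⟨a₃, ha₃, ha₃B⟩ := E_point_on_A h3 hA hB h3'.1 h3'.2.1 h3'.2.2.1 h3'.2.2.2
  have n12 : a₁ ≠ a₂ := fun h => E_points_ne hw1 hcard h3 h7 hA hB h1.1 h2.1 hAB h1.2.1 h1.2.2.1 h2.2.1 h2.2.2.1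
    h12.symm h1.2.2.2 h2.2.2.2 ha₁ (h ▸ ha₂)
  have n13 : a₁ ≠ a₃ := fun h => E_points_ne hw1 hcard h3 h7 hA hB h1.1 h3'.1 hAB h1.2.1 h1.2.2.1 h3'.2.1 h3'.2.2.1
    h13.symm h1.2.2.2 h3'.2.2.2 ha₁ (h ▸ ha₃)
  have n23 : a₂ ≠ a₃ := fun h => E_points_ne hw1 hcard h3 h7 hA hB h2.1 h3'.1 hAB h2.2.1 h2.2.2.1 h3'.2.1 h3'.2.2.1
    h23.symm h2.2.2.2 h3'.2.2.2 ha₂ (h ▸ ha₃)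
  have hsub : ({a₁, a₂, a₃} : Finset β) ⊆ A \ B := by
    intro x hx
    simp only [Finset.mem_insert, Finset.mem_singleton] at hx
    rw [Finset.mem_sdiff]
    rcases hx with rfl | rfl | rfl
    · exact ⟨(Finset.mem_inter.1 (ha₁ ▸ Finset.mem_singleton_self _)).2, ha₁B⟩
    · exact ⟨(Finset.mem_inter.1 (ha₂ ▸ Finset.mem_singleton_self _)).2, ha₂B⟩
    · exact ⟨(Finset.mem_inter.1 (ha₃ ▸ Finset.mem_singleton_self _)).2, ha₃B⟩
  have hc := Finset.card_le_card hsub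
  rw [Finset.card_insert_of_notMem (by simp [n12, n13]), Finset.card_pair n23] at hc
  have := Finset.card_sdiff_add_card_inter A B
  rw [Finset.inter_comm] at this
  have := hcard A hA
  omega
end Lines

end FourCap

end S1

end PercRepro
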